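import Literature.IUT.HodgeArakelov.MonoThetaProjectiveProp15ivHullProofs
import Literature.IUT.HodgeArakelov.ThetaValueOrbitsProofs
import Summits.ABC.IUTFork.Conditional.Layer6OfSa
import Summits.ABC.IUTFork.DAGL6b
import Summits.ABC.IUTFork.DAGL6d
import Summits.ABC.IUTFork.DAGL6p
import Summits.ABC.IUTFork.DAGL6q
import Summits.ABC.IUTFork.DAGL6r
import Summits.ABC.IUTFork.DAGL6s
import Summits.ABC.IUTFork.DAGL6w
import Summits.ABC.IUTFork.DAGL6x
import Summits.ABC.IUTFork.DAGL6zb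
import Summits.ABC.IUTFork.DAGRe
import Summits.ABC.IUTFork.DAGXa

/-!
# L6 LAYER CERTIFICATE, part A — FOLD FILE (proof-only companion of `Layer6OfSa.lean`)

abc-iut cell, CERT-L6-A (abc-iut-w5-d012 gen 4; maintained by gen 5 from NODES v3.4at). The def-bearing certificate `Conditional/Layer6OfSa.lean` is FROZEN (kernel packaging of record
v5 + fold theorems v3.4ae/v3.4af/v3.4ag; the gate's append-only rule forbids moving conjuncts between its definitions). From NODES
v3.4ah on, THIS proof-only file carries (i) the LIVE COUNT LINE of part A and (ii) one theorem
`layer6DischargedA_<fold>_holds` per NODES fold, naming BY NAME the index kernel witnesses (`_holds`/`_part`, index sub-rows) of the rows that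
became NODES-discharged in that fold and are not yet witnessed inside `Layer6DischargedA` or an earlier fold theorem. THIS FILE PROVES NOTHING NEW
(terms of landed index names only) AND ASSERTS NOTHING about print; kernel-witnessed ≠ lead-discharged; typed ≠ proved; indexed ≠ endorsed;
nothing here asserts that abc is proved or refuted or takes a side on [IUTchIII] Cor. 3.12. [claim: Mochizuki2012, status: disputed]

COUNT LINE @ NODES v3.4cd (§F v1.19s split «nodes = d_nodes + d_idx + r + d_data + f + not-indexed»; R-def (b)) — SUPERSEDES the count line in
`Layer6OfSa.lean`'s docstring when newer:
119 = d_nodes 91 (NODES-discharged = lead-certified print coverage: 35 Corollary + 16 Definition + 12 Example + 28 Proposition) + d_idx 0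
(index-discharged, NODES-landed: ) + r 1 (Residual: NODES-landed claim nodes, incl. 1 NODES-«discharged» rows HELD in r by L6-lead ruling —
Prop1.3(iii): VALUE-identification residual G-w4d042-1 held until a genuine `BsGalData` (C-hgal-2 finding, C-R50, L6-lead §F v1.19bh (1)/v1.19bi
(1); NODES token «DISCHARGED MODULO HGAL» kept)) + d_data 24 (K4 data/slot-only, listed in Layer6OfSa.lean; 24 NODES-discharged) + f 3 (K3 schemas)
+ not-indexed 0. 91 + 0 + 1 + 24 + 3 + 0 = 119. L6 SCOREBOARD (lead, print-coverage) = d_nodes; d_idx = kernel theorems of index Props whose print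
coverage the lead has not yet certified.

FOLD TABLE (NODES version → rows whose kernel witnesses entered → theorem · file):
* v3.4ae: Cor1.11, Cor4.5(ii), Cor4.5(iii), Cor4.6(iv), Prop1.2(i), Prop1.5(i) → `layer6DischargedA_v3_4ae_holds` (10 conjuncts) · Layer6OfSa.lean
* v3.4af: Cor1.12(i), Prop1.4 → `layer6DischargedA_v3_4af_holds` (3 conjuncts) · Layer6OfSa.lean
* v3.4ag: Prop1.2(ii) → `layer6DischargedA_v3_4ag_holds` (1 conjunct) · Layer6OfSa.lean
* v3.4ah: Cor1.10, Cor2.5(ii), Cor2.6(ii), Cor2.8(i), Cor4.10(i), Cor4.10(ii), Cor4.10(iii), Cor4.10(vi), Cor4.11(i), Cor4.11(ii), Cor4.11(iii),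
Cor4.5(v), Prop4.1(iii) → `layer6DischargedA_v3_4ah_holds` (20 conjuncts) · this file
* v3.4ai: Cor3.6(i), Def2.3(v) → `layer6DischargedA_v3_4ai_holds` (2 conjuncts) · this file
* v3.4al: Cor1.12(iii) → `layer6DischargedA_v3_4al_holds` (2 conjuncts) · this file
* v3.4am: Cor4.5(iv) → `layer6DischargedA_v3_4am_holds` (1 conjunct) · this file
* v3.4an: Cor4.10(v), Cor4.5(ii), Cor4.6(v), Prop1.5(iii), Prop4.1(ii), Prop4.4(ii), Prop4.4(iii), Prop4.4(iv) → `layer6DischargedA_v3_4an_holds` (8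
conjuncts) · this file
* v3.4ao: Prop3.4(ii) → `layer6DischargedA_v3_4ao_holds` (1 conjunct) · this file
* v3.4ap: Cor2.4(ii) → `layer6DischargedA_v3_4ap_holds` (8 conjuncts) · this file
* v3.4aq: Cor2.5(i) → `layer6DischargedA_v3_4aq_holds` (1 conjunct) · this file
* v3.4as: Cor2.4(i), Prop2.2(i) → `layer6DischargedA_v3_4as_holds` (3 conjuncts) · this file
* v3.4av: Cor2.4(iii), Prop1.3(i), Prop2.1 → `layer6DischargedA_v3_4av_holds` (3 conjuncts) · this file
* v3.4bb: Prop3.1(ii), Prop3.3(i), Prop3.3(ii) → `layer6DischargedA_v3_4bb_holds` (3 conjuncts) · this file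
* v3.4bl: Prop3.4(i) → `layer6DischargedA_v3_4bl_holds` (1 conjunct) · this file
* v3.4cb: Prop3.1(i) → `layer6DischargedA_v3_4cb_holds` (1 conjunct) · this file
* v3.4cd: Prop2.2(ii) → `layer6DischargedA_v3_4cd_holds` (4 conjuncts) · this file

HISTORY NOTES (status round trips / re-keys affecting the count classes; kernel theorems below are never mutated):
* Cor2.4(ii): NODES-discharged v3.4ap (fold theorem `layer6DischargedA_v3_4ap_holds`) → reverted to landed at v3.4at (typed statement VACUOUS at the
containment-keyed datum, `cor24_ii_iii'_ofCoverModel_of_containment` p444923 / p442973) → RE-FLIPPED discharged at v3.4au on the NON-VACUOUS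
intersection-keyed assembly `cor24_ii_iii′_ofCoverModel_of_inter_of_origin` + `exists_interKeyed_cuspidalInertiaData_ofCoverModel` (p444923, holder
w6-d069); the v3.4ap theorem is unchanged (its conjuncts are the index Props, inhabited either way); counted in d_nodes from v3.4au.
* Def2.3(iii), Def2.3(iv): d_idx (index-discharged, kernel witness inside the frozen `Layer6DischargedA`) → d_nodes at v3.4au (lead flips
AS-DEFINITION(+JUNCTION) on L6-t19 g6's clause lines; F-0438 / F-0440 consumed at named instances).
* Def1.1(i), Def1.1(ii), Def2.3(ii): d_idx → d_nodes at v3.4av (lead flips on w4-d043 g6's §1 batch 1/3 lines and L6-t19 g6's DEF23ii-COMM p445460;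
kernel witnesses already inside the frozen `Layer6DischargedA`). Cor2.4(iii), Prop1.3(i), Prop2.1: Residual → d_nodes at v3.4av (JUNCTION flips; index
`_part` witnesses enter in `layer6DischargedA_v3_4av_holds`).
* Def2.3(i): d_idx → d_nodes at v3.4ax (lead flips AS-DEFINITION-AT-THE-GENUINE-TOWER on L6-t19 g6's DEF23i-LINE, knit p448743 + NV p448223; kernel
witness already inside the frozen `Layer6DischargedA`). From v3.4ax the f 3 rows (Cor2.8(ii)(iii), Prop1.5(iv): index heads are parametrised schemas)
carry their landed INSTANCE-FORM theorems BY NAME in `layer6FlaggedA_instanceForms_holds` (K3; count class unchanged).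
* Def2.3(v): d_idx → d_nodes at v3.4az (lead flips AS-DEFINITION-AT-THE-GENUINE-TOWER on w5-d132 g6's line; `card_labCuspPM_ofPiCHat_eq_l` p449023,
`nonempty_flTorsorStructureConj_ofPiCHat` p450102; index witness `N_IUTchII_Def2_3_v_holds` already inside the frozen `Layer6DischargedA`) ⇒ d_idx =
0: every index-discharged part-A row is now also NODES-discharged. Prop1.3(iii), Prop3.4(i): NODES «DISCHARGED MODULO HGAL» (C-R25) from v3.4ay — kept
in class r by ruling (§F v1.19av (2)) until the hgal FACT row is retyped (option A) or B is chosen.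
* Prop3.1(ii), Prop3.3(i), Prop3.3(ii)′: Residual → d_nodes at v3.4bb (first fold of L6-lead gen 5, on holder w5-d169 g5's PROP31ii-33-LINES:
Prop3.1(ii) discharged modulo DATA J4 / class-R hq / F-0620 BY ID; Prop3.3(i) and Prop3.3(ii) DISCHARGED-CONDITIONAL on DATA J5/J6/J7); index `_part`
witnesses enter in `layer6DischargedA_v3_4bb_holds` (Prop3.3(ii)′ is the late-residual re-key, outside the frozen `Layer6ResidualA`). r 4 =
Prop1.3(iii)ʰ, Prop2.2(ii), Prop3.1(i), Prop3.4(i)ʰ.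
* v3.4bk (L6-lead gen 6 §F v1.19bh/bi, C-R50): Prop1.3(iii) RE-CLASSED inside r — no longer «modulo hgal» but VALUE-identification residual G-w4d042-1
(K4 site F-2780 `Cor110cNatural` / F-0664), held until a genuine `BsGalData`; Cor1.11 (d_nodes since v3.4am, fold theorem
`layer6DischargedA_v3_4ae_holds` in Layer6OfSa.lean) RE-TAGGED «modulo hgal» in NODES pending the second C-R46 (c) companion — NO class/count move by
the lead's ruling (K-L6 meter 149/188 unchanged); Prop3.4(i) stays held «modulo hgal» until its companion + rule-(3) line land.
* v3.4bl (L6-lead gen 6 §F v1.19bm (1); plan C-R46 (c) / C-R50 / C-R54): Prop3.4(i) r → d_nodes — the «modulo hgal» qualifier STRUCK on the C-R46 (c)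
companion p466250 ✓ (C-hgal-2 g0; RQ7 second read SOUND, w5-d169 g8 20:39Z) which binds the re-typed FACT BY ID `AbsTopIII.Cor_1_10_iii_natural`
(p465730, f-052; F-0396 / F-0348 OPTION A, interface-typed over `ThetaSetting`) + the origin datum `hj : IsAlgebraic ℚ (tateJ D.qX)`; index witness
`N_IUTchII_Prop3_4_i_part` enters in `layer6DischargedA_v3_4bl_holds`. r 3 = Prop1.3(iii) (VALUE-identification G-w4d042-1, NODES words «DISCHARGED
MODULO HGAL» kept ⇒ held), Prop2.2(ii), Prop3.1(i). Cor1.11 (d_nodes since v3.4am) keeps the «modulo hgal» TAG pending companion 2/2 — no class/count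
move.

LATE RESIDUAL ROWS (became Residual claim nodes after v5 — index re-keys — and are therefore NOT inside the frozen `Layer6ResidualA`; each is kernel-inhabited by its index `_part`, recorded in `layer6ResidualA_late_<tag>_inhabited` below; counted in r above UNLESS since flipped to NODES-discharged, as stated per row): Prop3.3(ii) (late Residual since v3.4an; NODES-discharged since v3.4bb — now counted in d_nodes, kernel witness in `layer6DischargedA_v3_4bb_holds`).

Rows NODES-discharged since v5 that sit inside the frozen `Layer6ResidualA` (all witnessed in fold theorems): Cor1.10, Cor1.11, Cor1.12(i), Cor1.12(iii), Cor2.4(i), Cor2.4(ii), Cor2.4(iii), Cor2.5(i), Cor2.5(ii), Cor2.6(ii), Cor2.8(i), Cor4.10(i), Cor4.10(ii), Cor4.10(iii), Cor4.10(vi), Cor4.11(i), Cor4.11(ii), Cor4.11(iii), Cor4.5(iii), Cor4.5(iv), Cor4.5(v), Prop1.2(i), Prop1.2(ii), Prop1.3(i), Prop1.4, Prop1.5(i), Prop2.1, Prop2.2(i), Prop2.2(ii), Prop3.1(i), Prop3.1(ii), Prop3.3(i), Prop3.4(i), Prop3.4(ii), Prop4.1(iii).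
The residual conjunction itself is kernel-inhabited (`layer6ResidualA_inhabited`, Layer6OfSaWitness p429165); r above is the NODES count.
-/

namespace Summit.ABC.IUTFork.Conditional

open Summit.ABC.IUTFork.DAG

universe u₁ u₂ u₃ u₄ u₅ u₆ u₇ u₈ u₉

/-- **FOLD v3.4ah** — kernel witnesses BY NAME that ENTERED at NODES v3.4ah (rows flipped to NODES-discharged, and/or index names newly
available for already-listed rows: new `_holds` / sub-rows / newly indexed nodes) and were not witnessed earlier:
Cor1.10, Cor2.5(ii), Cor2.6(ii), Cor2.8(i), Cor4.10(i), Cor4.10(ii), Cor4.10(iii), Cor4.10(vi), Cor4.11(i), Cor4.11(ii), Cor4.11(iii), Cor4.5(v), Prop4.1(iii) (20 conjuncts: index Props / closed sub-rows). Appended, never mutated.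
[claim: Mochizuki2012, status: disputed] -/
theorem layer6DischargedA_v3_4ah_holds :
    N_IUTchII_Cor1_10.{u₁}
    ∧ N_IUTchII_Cor1_10_r1.{u₁}
    ∧ N_IUTchII_Cor1_10_r7.{u₁}
    ∧ N_IUTchII_Cor1_10_r9.{u₁}
    ∧ N_IUTchII_Cor1_10_r10.{u₁}
    ∧ N_IUTchII_Cor1_10_C110.{u₁}
    ∧ N_IUTchII_Cor2_5_ii.{u₁}
    ∧ N_IUTchII_Cor2_6_ii.{u₁}
    ∧ N_IUTchII_Cor2_8_i.{u₁, u₂}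
    ∧ N_IUTchII_Cor4_10_i.{u₁, u₂, u₃, u₄, u₅, u₆, u₇, u₈}
    ∧ N_IUTchII_Cor4_10_ii.{u₁, u₂, u₃, u₄, u₅, u₆, u₇, u₈}
    ∧ N_IUTchII_Cor4_10_iii.{u₁, u₂, u₃, u₄, u₅, u₆, u₇, u₈}
    ∧ N_IUTchII_Cor4_10_vi
    ∧ N_IUTchII_Cor4_11_i.{u₁, u₂, u₃, u₄, u₅, u₆, u₇, u₈}
    ∧ N_IUTchII_Cor4_11_ii
    ∧ N_IUTchII_Cor4_11_iii.{u₁, u₂, u₃, u₄, u₅, u₆, u₇}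
    ∧ N_IUTchII_Cor4_5_v.{u₁, u₂, u₃}
    ∧ N_IUTchII_Cor4_5_v_r14.{u₁}
    ∧ N_IUTchII_Cor4_5_v_r15.{u₁, u₂, u₃}
    ∧ N_IUTchII_Prop4_1_iii.{u₁, u₂} :=
  ⟨N_IUTchII_Cor1_10_part, N_IUTchII_Cor1_10_r1_holds, N_IUTchII_Cor1_10_r7_holds,
    N_IUTchII_Cor1_10_r9_holds, N_IUTchII_Cor1_10_r10_holds, N_IUTchII_Cor1_10_C110_holds,
    N_IUTchII_Cor2_5_ii_part, N_IUTchII_Cor2_6_ii_part, N_IUTchII_Cor2_8_i_part,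
    N_IUTchII_Cor4_10_i_part, N_IUTchII_Cor4_10_ii_part, N_IUTchII_Cor4_10_iii_part,
    N_IUTchII_Cor4_10_vi_part, N_IUTchII_Cor4_11_i_part, N_IUTchII_Cor4_11_ii_part,
    N_IUTchII_Cor4_11_iii_part, N_IUTchII_Cor4_5_v_part, N_IUTchII_Cor4_5_v_r14_holds,
    N_IUTchII_Cor4_5_v_r15_holds, N_IUTchII_Prop4_1_iii_part⟩

/-- **FOLD v3.4ai** — kernel witnesses BY NAME that ENTERED at NODES v3.4ai (rows flipped to NODES-discharged, and/or index names newly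
available for already-listed rows: new `_holds` / sub-rows / newly indexed nodes) and were not witnessed earlier:
Cor3.6(i), Def2.3(v) (2 conjuncts: index Props / closed sub-rows). Appended, never mutated.
[claim: Mochizuki2012, status: disputed] -/
theorem layer6DischargedA_v3_4ai_holds :
    N_IUTchII_Cor3_6_i_r3.{u₁, u₂, u₃, u₄, u₅, u₆}
    ∧ N_IUTchII_Def2_3_v.{u₁} :=
  ⟨N_IUTchII_Cor3_6_i_r3_holds, N_IUTchII_Def2_3_v_holds⟩

/-- **FOLD v3.4al** — kernel witnesses BY NAME that ENTERED at NODES v3.4al (rows flipped to NODES-discharged, and/or index names newly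
available for already-listed rows: new `_holds` / sub-rows / newly indexed nodes) and were not witnessed earlier:
Cor1.12(iii) (2 conjuncts: index Props / closed sub-rows). Appended, never mutated.
[claim: Mochizuki2012, status: disputed] -/
theorem layer6DischargedA_v3_4al_holds :
    N_IUTchII_Cor1_12_iii.{u₁}
    ∧ N_IUTchII_Cor1_12_iii_r8.{u₁, u₂, u₃, u₄} :=
  ⟨N_IUTchII_Cor1_12_iii_part, N_IUTchII_Cor1_12_iii_r8_holds⟩

/-- **FOLD v3.4am** — kernel witnesses BY NAME that ENTERED at NODES v3.4am (rows flipped to NODES-discharged, and/or index names newly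
available for already-listed rows: new `_holds` / sub-rows / newly indexed nodes) and were not witnessed earlier:
Cor4.5(iv) (1 conjuncts: index Props / closed sub-rows). Appended, never mutated.
[claim: Mochizuki2012, status: disputed] -/
theorem layer6DischargedA_v3_4am_holds :
    N_IUTchII_Cor4_5_iv.{u₁, u₂} :=
  N_IUTchII_Cor4_5_iv_part

/-- **FOLD v3.4an** — kernel witnesses BY NAME that ENTERED at NODES v3.4an (rows flipped to NODES-discharged, and/or index names newly
available for already-listed rows: new `_holds` / sub-rows / newly indexed nodes) and were not witnessed earlier:
Cor4.10(v), Cor4.5(ii), Cor4.6(v), Prop1.5(iii), Prop4.1(ii), Prop4.4(ii), Prop4.4(iii), Prop4.4(iv) (8 conjuncts: index Props / closed sub-rows). Appended, never mutated.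
[claim: Mochizuki2012, status: disputed] -/
theorem layer6DischargedA_v3_4an_holds :
    N_IUTchII_Cor4_10_v'.{u₁, u₂, u₃, u₄}
    ∧ N_IUTchII_Cor4_5_ii'.{u₁, u₂, u₃, u₄}
    ∧ N_IUTchII_Cor4_6_v'.{u₁, u₂}
    ∧ N_IUTchII_Prop1_5_iii'.{u₁, u₂}
    ∧ N_IUTchII_Prop4_1_ii'.{u₁}
    ∧ N_IUTchII_Prop4_4_ii'.{u₁, u₂}
    ∧ N_IUTchII_Prop4_4_iii'.{u₁, u₂}
    ∧ N_IUTchII_Prop4_4_iv'.{u₁, u₂} :=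
  ⟨N_IUTchII_Cor4_10_v'_part, N_IUTchII_Cor4_5_ii'_holds, N_IUTchII_Cor4_6_v'_holds,
    N_IUTchII_Prop1_5_iii'_holds, N_IUTchII_Prop4_1_ii'_holds, N_IUTchII_Prop4_4_ii'_holds,
    N_IUTchII_Prop4_4_iii'_holds, N_IUTchII_Prop4_4_iv'_holds⟩

/-- **FOLD v3.4ao** — kernel witnesses BY NAME that ENTERED at NODES v3.4ao (rows flipped to NODES-discharged, and/or index names newly
available for already-listed rows: new `_holds` / sub-rows / newly indexed nodes) and were not witnessed earlier:
Prop3.4(ii) (1 conjuncts: index Props / closed sub-rows). Appended, never mutated.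
[claim: Mochizuki2012, status: disputed] -/
theorem layer6DischargedA_v3_4ao_holds :
    N_IUTchII_Prop3_4_ii.{u₁, u₂, u₃} :=
  N_IUTchII_Prop3_4_ii_part

/-- **FOLD v3.4ap** — kernel witnesses BY NAME that ENTERED at NODES v3.4ap (rows flipped to NODES-discharged, and/or index names newly
available for already-listed rows: new `_holds` / sub-rows / newly indexed nodes) and were not witnessed earlier:
Cor2.4(ii) (8 conjuncts: index Props / closed sub-rows). Appended, never mutated.
[claim: Mochizuki2012, status: disputed] -/
theorem layer6DischargedA_v3_4ap_holds :
    N_IUTchII_Cor2_4_ii.{u₁}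
    ∧ N_IUTchII_Cor2_4_ii_r1.{u₁}
    ∧ N_IUTchII_Cor2_4_ii_r2.{u₁}
    ∧ N_IUTchII_Cor2_4_ii_r3.{u₁}
    ∧ N_IUTchII_Cor2_4_ii_r4.{u₁}
    ∧ N_IUTchII_Cor2_4_ii_r8.{u₁}
    ∧ N_IUTchII_Cor2_4_ii_r9.{u₁}
    ∧ N_IUTchII_Cor2_4_ii_r10.{u₁} :=
  ⟨N_IUTchII_Cor2_4_ii_part, N_IUTchII_Cor2_4_ii_r1_holds, N_IUTchII_Cor2_4_ii_r2_holds,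
    N_IUTchII_Cor2_4_ii_r3_holds, N_IUTchII_Cor2_4_ii_r4_holds, N_IUTchII_Cor2_4_ii_r8_holds,
    N_IUTchII_Cor2_4_ii_r9_holds, N_IUTchII_Cor2_4_ii_r10_holds⟩

/-- **FOLD v3.4aq** — kernel witnesses BY NAME that ENTERED at NODES v3.4aq (rows flipped to NODES-discharged, and/or index names newly
available for already-listed rows: new `_holds` / sub-rows / newly indexed nodes) and were not witnessed earlier:
Cor2.5(i) (1 conjuncts: index Props / closed sub-rows). Appended, never mutated.
[claim: Mochizuki2012, status: disputed] -/
theorem layer6DischargedA_v3_4aq_holds :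
    N_IUTchII_Cor2_5_i.{u₁} :=
  N_IUTchII_Cor2_5_i_part

/-- **FOLD v3.4as** — kernel witnesses BY NAME that ENTERED at NODES v3.4as (rows flipped to NODES-discharged, and/or index names newly
available for already-listed rows: new `_holds` / sub-rows / newly indexed nodes) and were not witnessed earlier:
Cor2.4(i), Prop2.2(i) (3 conjuncts: index Props / closed sub-rows). Appended, never mutated.
[claim: Mochizuki2012, status: disputed] -/
theorem layer6DischargedA_v3_4as_holds :
    N_IUTchII_Cor2_4_i.{u₁, u₂}
    ∧ N_IUTchII_Prop2_2_i.{u₁}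
    ∧ N_IUTchII_Prop2_2_i_r8.{u₁} :=
  ⟨N_IUTchII_Cor2_4_i_part, N_IUTchII_Prop2_2_i_part, N_IUTchII_Prop2_2_i_r8_holds⟩

/-- **FOLD v3.4av** — kernel witnesses BY NAME that ENTERED at NODES v3.4av (rows flipped to NODES-discharged, and/or index names newly
available for already-listed rows: new `_holds` / sub-rows / newly indexed nodes) and were not witnessed earlier:
Cor2.4(iii), Prop1.3(i), Prop2.1 (3 conjuncts: index Props / closed sub-rows). Appended, never mutated.
[claim: Mochizuki2012, status: disputed] -/
theorem layer6DischargedA_v3_4av_holds :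
    N_IUTchII_Cor2_4_iii.{u₁}
    ∧ N_IUTchII_Prop1_3_i.{u₁, u₂}
    ∧ N_IUTchII_Prop2_1.{u₁} :=
  ⟨N_IUTchII_Cor2_4_iii_part, N_IUTchII_Prop1_3_i_part, N_IUTchII_Prop2_1_part⟩

/-- **FOLD v3.4bb** — kernel witnesses BY NAME that ENTERED at NODES v3.4bb (rows flipped to NODES-discharged, and/or index names newly
available for already-listed rows: new `_holds` / sub-rows / newly indexed nodes) and were not witnessed earlier:
Prop3.1(ii), Prop3.3(i), Prop3.3(ii) (3 conjuncts: index Props / closed sub-rows). Appended, never mutated.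
[claim: Mochizuki2012, status: disputed] -/
theorem layer6DischargedA_v3_4bb_holds :
    N_IUTchII_Prop3_1_ii.{u₁}
    ∧ N_IUTchII_Prop3_3_i.{u₁, u₂}
    ∧ N_IUTchII_Prop3_3_ii' :=
  ⟨N_IUTchII_Prop3_1_ii_part, N_IUTchII_Prop3_3_i_part, N_IUTchII_Prop3_3_ii'_part⟩

/-- **FOLD v3.4bl** — kernel witnesses BY NAME that ENTERED at NODES v3.4bl (rows flipped to NODES-discharged, and/or index names newly
available for already-listed rows: new `_holds` / sub-rows / newly indexed nodes) and were not witnessed earlier: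
Prop3.4(i) (1 conjuncts: index Props / closed sub-rows). Appended, never mutated.
[claim: Mochizuki2012, status: disputed] -/
theorem layer6DischargedA_v3_4bl_holds :
    N_IUTchII_Prop3_4_i.{u₁, u₂} :=
  N_IUTchII_Prop3_4_i_part

/-- **FOLD v3.4cb** — kernel witnesses BY NAME that ENTERED at NODES v3.4cb (rows flipped to NODES-discharged, and/or index names newly
available for already-listed rows: new `_holds` / sub-rows / newly indexed nodes) and were not witnessed earlier:
Prop3.1(i) (1 conjuncts: index Props / closed sub-rows). Appended, never mutated.
[claim: Mochizuki2012, status: disputed] -/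
theorem layer6DischargedA_v3_4cb_holds :
    N_IUTchII_Prop3_1_i.{u₁, u₂} :=
  N_IUTchII_Prop3_1_i_part

/-- **FOLD v3.4cd** — kernel witnesses BY NAME that ENTERED at NODES v3.4cd (rows flipped to NODES-discharged, and/or index names newly
available for already-listed rows: new `_holds` / sub-rows / newly indexed nodes) and were not witnessed earlier:
Prop2.2(ii) (4 conjuncts: index Props / closed sub-rows). Appended, never mutated.
[claim: Mochizuki2012, status: disputed] -/
theorem layer6DischargedA_v3_4cd_holds :
    N_IUTchII_Prop2_2_ii.{u₁}
    ∧ N_IUTchII_Prop2_2_ii_r11.{u₁}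
    ∧ N_IUTchII_Prop2_2_ii_r14
    ∧ N_IUTchII_Prop2_2_ii_r15.{u₁} :=
  ⟨N_IUTchII_Prop2_2_ii_part, N_IUTchII_Prop2_2_ii_r11_holds, N_IUTchII_Prop2_2_ii_r14_holds,
    N_IUTchII_Prop2_2_ii_r15_holds⟩

/-- **LATE RESIDUAL @ v3.4an** — rows that became Residual claim nodes at NODES v3.4an (index re-key) and are not inside the frozen
`Layer6ResidualA`: Prop3.3(ii). Their index Props are kernel-inhabited BY NAME (typed statements are theorems as typed);
NODES status «landed» = print coverage not lead-certified. Appended, never mutated. [claim: Mochizuki2012, status: disputed] -/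
theorem layer6ResidualA_late_v3_4an_inhabited :
    N_IUTchII_Prop3_3_ii' :=
  N_IUTchII_Prop3_3_ii'_part

/-- **FLAGGED ROWS (f 3) — INSTANCE FORMS BY NAME (K3).** The three part-A cone rows whose index head is a PARAMETRISED schema
with no closed `_part`/`_holds`/sub-row in the index — Cor2.8(ii) (`N_IUTchII_Cor2_8_ii := @ThetaValueOrbits.Cor28ii_functorialAlgorithm`),
Cor2.8(iii) (`N_IUTchII_Cor2_8_iii := @ThetaValueOrbits.Cor28iii_splitting`), Prop1.5(iv) (`N_IUTchII_Prop1_5_iv := @Prop15_iv_compatible`) —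
are all NODES-discharged (p405745 · p407386 · p407497 + p429231 p432317). Rule K3 (L6-lead §F v1.19n): a schema is never ∀-closed in the
certificate; the A writer cites the landed INSTANCE-FORM theorems BY NAME. This theorem does exactly that, in the index's own device
(`PartL6b.StatementOf h` = the statement of which the landed `h` is the proof): `ThetaValueOrbits.cor28ii_canonical` (the outputs at the
canonical orbits satisfy `Cor28ii_functorialAlgorithm`; p405745), `ThetaValueOrbits.cor28iii_of_transport` and `cor28iii_unique` (the
zero-label splitting transported along the first restriction operation satisfies `Cor28iii_splitting`, and compatibility determines it;
p405745, packaging p407386), `EtaleLevels.prop15_iv_thetaEnvDataNatural_kummer_and_hull` (at the genuine natural system, for every `l`-th root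
`g` of the Kummer class the transported θ-set satisfies `Prop15_iv_compatible`, with the hull's Kummer map injective/equivariant; p432317).
COUNT CLASS UNCHANGED (f 3: flagged, instance forms cited); proves nothing new; the instance theorems keep their own hypotheses (named in
their files). [claim: Mochizuki2012, status: disputed] -/
theorem layer6FlaggedA_instanceForms_holds :
    PartL6b.StatementOf @Literature.IUT.HodgeArakelov.ThetaValueOrbits.cor28ii_canonical.{u₁, u₂}
    ∧ PartL6b.StatementOf @Literature.IUT.HodgeArakelov.ThetaValueOrbits.cor28iii_of_transport.{u₁}
    ∧ PartL6b.StatementOf @Literature.IUT.HodgeArakelov.ThetaValueOrbits.cor28iii_unique.{u₁}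
    ∧ PartL6b.StatementOf @Literature.IUT.HodgeArakelov.EtaleLevels.prop15_iv_thetaEnvDataNatural_kummer_and_hull :=
  ⟨@Literature.IUT.HodgeArakelov.ThetaValueOrbits.cor28ii_canonical.{u₁, u₂},
    @Literature.IUT.HodgeArakelov.ThetaValueOrbits.cor28iii_of_transport.{u₁},
    @Literature.IUT.HodgeArakelov.ThetaValueOrbits.cor28iii_unique.{u₁},
    @Literature.IUT.HodgeArakelov.EtaleLevels.prop15_iv_thetaEnvDataNatural_kummer_and_hull⟩

end Summit.ABC.IUTFork.Conditional
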